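import Summits.BirchSwinnertonDyer.BirchSwinnertonDyer.Theorems.ResidualThetaTransportAtTwoThetaLayerLambdaCongruenceAtTwoEulerFactorNonRoot
import Literature.NumberTheory.EllipticCurves.AtkinLehnerInvolutionsProofs
import Literature.NumberTheory.EllipticCurves.AtkinLehnerInvolutionsNewformProofs
import Literature.NumberTheory.EllipticCurves.CuspFormLFunctionLevelConductorProofs
import HarnessLib

/-!
# Crux `ThetaLayerLambdaCongruenceAtTwo` (stmt-BirchSwinnertonDyer-20688, route ResidualThetaTransportAtTwo), line
# `birth`: the Atkin–Lehner bound `|a_ℓ(g)| ≤ 1` at the level primes DISCHARGED from the tree, and the crux BY NAME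
# from (C3) + (μ-W₁) + Deligne's named fact alone (width seat bsd-wall-rtt-p3-w3 g2;
# `--supports stmt-BirchSwinnertonDyer-20688 --as helper`; closes nothing)

HONEST FRAMING. THEOREMS ONLY; the remaining inputs are the lead's research stub (C3), the curve-side (μ-W₁) and the
tree's NAMED FACT `Deligne1974_heckeT_eigenvalue_norm_le` (Deligne, Weil I, Thm. 8.2; unproved in the tree);
nothing about any curve or form is asserted; BSD is not proved by any of this.

WHAT. The hypothesis (AL) of `…EulerFactorNonRoot` — «`|a_ℓ(g)| ≤ 1` for a weight-`2` newform `g` on `Γ₀(N)` and a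
prime `ℓ ∣ N`» — is a tree theorem: if `ℓ² ∣ N` then `a_ℓ(g) = 0` (`cuspCoeff_eq_zero_of_sq_dvd_of_mem_newSubspace0`,
Atkin–Lehner Thm. 3 / Li); if `ℓ ∥ N` then `a_ℓ(g) = −λ(ℓ)` with the Atkin–Lehner eigenvalue `λ(ℓ) = ±1`
(`IsNewform0.atkinLehnerEigenvalueAt_eq_neg_coeff_of_not_dvd`, `…_eq_one_or_eq_neg_one`, Knapp Thm. 9.27). Hence
`thetaLayerLambdaCongruenceAtTwo_of_plusLine_curveMax_deligne'`: THE CRUX BY NAME from (C3) + (μ-W₁) + Deligne's fact.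
With this file the partner `g` of route ResidualThetaTransportAtTwo carries no research or conjecture input on line
`birth`: its depleted plus symbol is non-zero by Deligne's theorem (injectivity of depletion, `…DepletionInjective`),
and everything else about it was discharged by w2/w3/the lead.

References: [AtkinLehner1970] Thm. 3; [Knapp1993] Thm. 9.27; [Deligne1974] Thm. 8.2.
-/

noncomputable section

-- justification: the `Summit.BirchSwinnertonDyer.BirchSwinnertonDyer.…` path repeats a component (route-file convention)
set_option linter.dupNamespace false

open scoped Classical MatrixGroups

open Polynomial CongruenceSubgroup Literature.NumberTheory.EllipticCurves Literature.NumberTheory.EllipticCurves.ModularForms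

namespace Summit.BirchSwinnertonDyer.BirchSwinnertonDyer.Theorems.ThetaLayerLambdaCongruenceAtTwo

/-- **`|a_ℓ(g)| ≤ 1` at the primes of the level** for a weight-`2` newform `g ∈ S₂(Γ₀(N))`: `a_ℓ = 0` if `ℓ² ∣ N`,
`a_ℓ = −λ(ℓ) = ∓1` if `ℓ ∥ N` (Atkin–Lehner). [cite: AtkinLehner1970, Thm. 3; Knapp1993, Thm. 9.27] -/
theorem norm_cuspCoeff_le_one_of_dvd_level {N : ℕ} [NeZero N] {f : CuspForm (CongruenceSubgroup.Gamma0 N) 2}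
    (hf : IsNewform0 f) {ℓ : ℕ} (hℓ : ℓ.Prime) (hℓN : ℓ ∣ N) : ‖cuspCoeff f ℓ‖ ≤ 1 := by
  by_cases hsq : ℓ ^ 2 ∣ N
  · rw [cuspCoeff_eq_zero_of_sq_dvd_of_mem_newSubspace0 hf.1 hℓ hsq, norm_zero]
    exact zero_le_one
  · haveI : Fact ℓ.Prime := ⟨hℓ⟩
    obtain ⟨M, hN⟩ := hℓN
    have hℓM : ¬ ℓ ∣ M := fun h ↦ hsq (by rw [hN, pow_two]; exact mul_dvd_mul_left ℓ h)
    have hlam := hf.atkinLehnerEigenvalueAt_eq_neg_coeff_of_not_dvd ℓ hN hℓM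
    have h1 := hf.atkinLehnerEigenvalueAt_eq_one_or_eq_neg_one hℓ ⟨M, hN⟩
    have hc : cuspCoeff f ℓ = -atkinLehnerEigenvalueAt f ℓ := by
      rw [hlam, neg_neg]
      rfl
    rw [hc, norm_neg]
    rcases h1 with h | h
    · rw [h, norm_one]
    · rw [h, norm_neg, norm_one]

/-- **THE CRUX `ThetaLayerLambdaCongruenceAtTwo` BY NAME from (C3) + (μ-W₁) + DELIGNE'S NAMED FACT.** The only inputs:
the lead's plus-line stub (C3) (multiplicity one mod `2` for depleted plus-symbol functions; research, Buzzard Prop. 2.4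
shape), the CURVE-side (μ-W₁) («`W`'s depleted rational plus symbol attains its `2`-adic maximum over `ℚ` at a
`2`-power cusp of some even level»; per-curve finite check), and `Deligne1974_heckeT_eigenvalue_norm_le` (Weil I,
Thm. 8.2). [cite: Deligne1974, Thm. (8.2); GreenbergVatsal2000, §1 (10) (shape; the inputs are hypotheses)] -/
theorem thetaLayerLambdaCongruenceAtTwo_of_plusLine_curveMax_deligne'
    (hC3 : ∀ (W : WeierstrassCurve ℚ) [W.IsElliptic] [W.IsGloballyMinimal], Literature.NumberTheory.EllipticCurves.Rank1Residual.GoodSS W 2 → W.Δ < 0 → ∀ (N' : ℕ), Odd N' → (∀ ℓ : ℕ, ℓ.Prime → ℓ ∣ W.conductorNorm ℤ → ℓ ∣ N') → ∀ (Φ₁ Φ₂ : ℚ → PadicAlgCl 2), (∀ (r : ℚ) (z : ℤ), Φ₁ (r + z) = Φ₁ r) → (∀ r : ℚ, Φ₁ (-r) = Φ₁ r) → (∀ (γ : CongruenceSubgroup.Gamma0 (N')) (r : ℚ), ((γ : SL(2, ℤ)) 1 0 : ℚ) * r + ((γ : SL(2, ℤ)) 1 1 : ℚ) ≠ 0 →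 Φ₁ ((((γ : SL(2, ℤ)) 0 0 : ℚ) * r + ((γ : SL(2, ℤ)) 0 1 : ℚ)) / (((γ : SL(2, ℤ)) 1 0 : ℚ) * r + ((γ : SL(2, ℤ)) 1 1 : ℚ))) = (if ((γ : SL(2, ℤ)) 1 0) = 0 then 0 else Φ₁ ((((γ : SL(2, ℤ)) 0 0 : ℚ)) / (((γ : SL(2, ℤ)) 1 0 : ℚ)))) + Φ₁ r) → (∀ (r : ℚ) (z : ℤ), Φ₂ (r + z) = Φ₂ r) → (∀ r : ℚ, Φ₂ (-r) = Φ₂ r) → (∀ (γ : CongruenceSubgroup.Gamma0 (N')) (r : ℚ), ((γ : SL(2, ℤ)) 1 0 : ℚ) * r + ((γ : SL(2, ℤ)) 1 1 : ℚ) ≠ 0 → Φ₂ ((((γ : SL(2, ℤ)) 0 0 : ℚ) * r + ((γ : SL(2, ℤ)) 0 1 : ℚ)) / (((γ : SL(2, ℤ)) 1 0 : ℚ) * r + ((γ : SL(2, ℤ)) 1 1 : ℚ))) = (if ((γ : SL(2, ℤ)) 1 0) = 0 then 0 else Φ₂ ((((γ : SL(2, ℤ)) 0 0 : ℚ)) /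 (((γ : SL(2, ℤ)) 1 0 : ℚ)))) + Φ₂ r) → (∀ r : ℚ, ‖Φ₁ r‖ ≤ 1) → (∀ r : ℚ, ‖Φ₂ r‖ ≤ 1) → (∃ r : ℚ, ‖Φ₁ r‖ = 1) → (∃ r : ℚ, ‖Φ₂ r‖ = 1) → (∀ q : ℕ, q.Prime → ¬ q ∣ N' → ∀ r : ℚ, ‖(∑ j : Fin q, Φ₁ ((r + j) / q)) + Φ₁ (q * r) - (W.LFunction q : PadicAlgCl 2) * Φ₁ r‖ < 1) → (∀ q : ℕ, q.Prime → ¬ q ∣ N' → ∀ r : ℚ, ‖(∑ j : Fin q, Φ₂ ((r + j) / q)) + Φ₂ (q * r) - (W.LFunction q : PadicAlgCl 2) * Φ₂ r‖ < 1) → (∀ ℓ : ℕ, ℓ.Prime → ℓ ∣ N' → ∀ r : ℚ, ‖∑ j : Fin ℓ, Φ₁ ((r + j) / ℓ)‖ < 1) → (∀ ℓ : ℕ, ℓ.Prime → ℓ ∣ N' → ∀ r : ℚ, ‖∑ j : Fin ℓ, Φ₂ ((r + j) / ℓ)‖ < 1) → ∃ a : PadicAlgCl 2, ∀ r : ℚ,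 ‖a * Φ₁ r - Φ₂ r‖ < 1)
    (hμW : ∀ (W : WeierstrassCurve ℚ) [W.IsElliptic] [W.IsGloballyMinimal], ¬ W.HasCM → W.analyticRank = 0 → Literature.NumberTheory.EllipticCurves.Rank1Residual.GoodSS W 2 → W.frobeniusTrace 2 = 0 → W.Δ < 0 → ∀ [NeZero (W.conductorNorm ℤ)] (f : CuspForm (CongruenceSubgroup.Gamma0 (W.conductorNorm ℤ)) 2), Literature.NumberTheory.EllipticCurves.ModularForms.IsNewformOf W f → ∀ (S₀ : Finset (IsDedekindDomain.HeightOneSpectrum (NumberField.RingOfIntegers ℚ))), (∀ v ∈ S₀, ((2 : ℕ) : NumberField.RingOfIntegers ℚ) ∉ v.asIdeal) → (∀ v : IsDedekindDomain.HeightOneSpectrum (NumberField.RingOfIntegers ℚ), ¬ W.HasGoodReductionAt v → v ∈ S₀) → ∃ n₁ : ℕ, Even n₁ ∧ ∃ s : ZMod (2 ^ n₁), ∀ r : ℚ, ‖(∑ k ∈ Fintype.piFinset (fun _ : S₀ ↦ Finset.range 3), (∏ v : S₀, ((W.localPolynomialAt (v : IsDedekindDomain.HeightOneSpectrum (NumberField.RingOfIntegers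 ℚ))).map (Int.castRingHom (PadicAlgCl 2))).coeff (k v) * ((Rat.HeightOneSpectrum.natGenerator (v : IsDedekindDomain.HeightOneSpectrum (NumberField.RingOfIntegers ℚ)) : PadicAlgCl 2)⁻¹) ^ (k v)) * algebraMap ℚ (PadicAlgCl 2) (ratPlusSymbol f (r * ((∏ v : S₀, Rat.HeightOneSpectrum.natGenerator (v : IsDedekindDomain.HeightOneSpectrum (NumberField.RingOfIntegers ℚ)) ^ (k v) : ℕ) : ℚ))))‖ ≤ ‖(∑ k ∈ Fintype.piFinset (fun _ : S₀ ↦ Finset.range 3), (∏ v : S₀, ((W.localPolynomialAt (v : IsDedekindDomain.HeightOneSpectrum (NumberField.RingOfIntegers ℚ))).map (Int.castRingHom (PadicAlgCl 2))).coeff (k v) * ((Rat.HeightOneSpectrum.natGenerator (v : IsDedekindDomain.HeightOneSpectrum (NumberField.RingOfIntegers ℚ)) : PadicAlgCl 2)⁻¹) ^ (k v)) * algebraMap ℚ (PadicAlgCl 2) (ratPlusSymbol f ((((((Literature.NumberTheory.EllipticCurves.cyclotomicGenerator 2 : ZMod (2 ^ (n₁ + 2))) ^ s.val).val : ℚ)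 / (2 : ℚ) ^ (n₁ + 2))) * ((∏ v : S₀, Rat.HeightOneSpectrum.natGenerator (v : IsDedekindDomain.HeightOneSpectrum (NumberField.RingOfIntegers ℚ)) ^ (k v) : ℕ) : ℚ))))‖)
    (hD : Deligne1974_heckeT_eigenvalue_norm_le) :
    Summit.BirchSwinnertonDyer.BirchSwinnertonDyer.Theses.ResidualThetaTransportAtTwo.ThetaLayerLambdaCongruenceAtTwo :=
  thetaLayerLambdaCongruenceAtTwo_of_plusLine_curveMax_deligne hC3 hμW hD
    fun _N _ _f hf _ℓ hℓ hℓN ↦ norm_cuspCoeff_le_one_of_dvd_level hf hℓ hℓN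

end Summit.BirchSwinnertonDyer.BirchSwinnertonDyer.Theorems.ThetaLayerLambdaCongruenceAtTwo

end
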